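import Summits.QuantumFields.YangMills.Theorems.LuscherReductionTwistedTraceScalingStepKernelChart
import Summits.QuantumFields.YangMills.Theorems.LuscherReductionTwistedTraceScalingAdjointRotationAlgebra
import HarnessLib

/-!
# The covariant curl moves Lipschitz-continuously along a near step: `‖(D_{W·U} − D_U) w‖ ≤ 504 τ √N ‖w‖`
# (covariant programme, brick c2(iv) / c4(iii) input (m1)–(m2))

Cell `ym-fleet`, crux `TwistedTraceScaling` (stmt-QuantumFields-20203), line «twolattice», stub S-BASE, lane B = COARSE-LOWER(L₁)
(design note `pub/ym-fleet/ym-20203-coarse-s1/LOWER-BLUEPRINT.md` §5–§6).  HONEST FRAMING: `3 × 3` rotation-matrix bookkeeping on a fixed lattice;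
a stub of a child of the CONDITIONAL reduction route (femto rung R2b1); not a gap, not Clay.

The parallel transports in `D_U` (`Cov.covCurl_apply`: `Ad(P₁)`, `Ad(P₂)`, `Ad(P₃ = hol)`) are products of link variables; along a step `U ↦ W·U`
with `|vecPart(W_e)_c| ≤ τ ≤ 1` each `Ad(W_e)` is `4τ`-close to `1` entrywise, and `Ad` is multiplicative (`Cov.adRot_mul`):

* `abs_entry_mul_adRot_le` / `abs_entry_adRot_mul_le` — entry bounds of products with an adjoint rotation; `abs_adRot_sub_one_le` —
  `|(Ad(W) − 1)_{ab}| ≤ 4τ`;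
* `adRot_ptrans1_step_sub`, `adRot_ptrans2_step_sub`, `adRot_hol_step_sub` — telescoping identities for the three transports, and the entry bounds
  `12τ`, `60τ`, `96τ` (`abs_adRot_ptrans*_step_sub_le`);
* `abs_apply_le_norm`, ★ `norm_covCurl_le_op` — `‖D_U w‖ ≤ 10 √N ‖w‖` (`N = 3|P|`);
* ★★ `norm_covCurl_step_sub_le` — `‖D_{W·U} w − D_U w‖ ≤ 504 τ √N ‖w‖`.
These are the constants `C, C', C_Δ` of `Harm.abs_weightForm_sub_weightForm_le` (`…SpectralWeightContinuity`).

## References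
* M. Lüscher, Nucl. Phys. B219 (1983) 233, §3. [Luscher1983]
* T. Bröcker, T. tom Dieck, *Representations of Compact Lie Groups* (1985), I (1.10) (the adjoint `SU(2) → SO(3)`). [BrockerTomDieck1985]
-/

noncomputable section

open Real
open scoped Matrix
open Literature.MathematicalPhysics.QuantumFieldTheory
open Literature.MathematicalPhysics.QuantumLattice

namespace Summit.QuantumFields.YangMills.Theorems.FemtoTransferGap.TwoLattice.Cov

open Summit.QuantumFields.YangMills.Theorems.FemtoTransferGap
open Summit.QuantumFields.YangMills.Theorems.FemtoTransferGap.TwoLattice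
open Summit.QuantumFields.YangMills.Theorems.FemtoTransferGap.TwoLattice.Stiff

variable {L : ℕ} [NeZero L]

/-! ## §1 Entry bounds for `3 × 3` matrices -/

omit [NeZero L] in
/-- `|(M·Ad(V))_{ab}| ≤ 3 m` when `|M| ≤ m` entrywise (`|Ad(V)| ≤ 1`; the general entry bound for `3 × 3` products is
`Literature.Topology.FourManifolds.abs_mul_apply_le`). [cite: BrockerTomDieck1985, I (1.10)] -/
theorem abs_entry_mul_adRot_le {M : Matrix (Fin 3) (Fin 3) ℝ} {m : ℝ} (hM : ∀ a b, |M a b| ≤ m) (V : SU2) (a b : Fin 3) :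
    |(M * adRot V) a b| ≤ 3 * m := by
  have hm : 0 ≤ m := (abs_nonneg _).trans (hM 0 0)
  rw [Matrix.mul_apply]
  calc |∑ k, M a k * adRot V k b| ≤ ∑ k, |M a k * adRot V k b| := Finset.abs_sum_le_sum_abs _ _
    _ ≤ ∑ _k : Fin 3, m := Finset.sum_le_sum fun k _ => by
        rw [abs_mul]
        calc |M a k| * |adRot V k b| ≤ m * 1 := mul_le_mul (hM a k) (abs_adRot_le_one V k b) (abs_nonneg _) hm
          _ = m := mul_one m
    _ = 3 * m := by simp

omit [NeZero L] in
/-- `|(Ad(V)·N)_{ab}| ≤ 3 n` when `|N| ≤ n` entrywise. [cite: BrockerTomDieck1985, I (1.10)] -/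
theorem abs_entry_adRot_mul_le (V : SU2) {N : Matrix (Fin 3) (Fin 3) ℝ} {n : ℝ} (hN : ∀ a b, |N a b| ≤ n) (a b : Fin 3) :
    |(adRot V * N) a b| ≤ 3 * n := by
  rw [Matrix.mul_apply]
  calc |∑ k, adRot V a k * N k b| ≤ ∑ k, |adRot V a k * N k b| := Finset.abs_sum_le_sum_abs _ _
    _ ≤ ∑ _k : Fin 3, n := Finset.sum_le_sum fun k _ => by
        rw [abs_mul]
        calc |adRot V a k| * |N k b| ≤ 1 * |N k b| := mul_le_mul_of_nonneg_right (abs_adRot_le_one V a k) (abs_nonneg _)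
          _ ≤ n := by rw [one_mul]; exact hN k b
    _ = 3 * n := by simp

omit [NeZero L] in
/-- Entries of a transpose. [folklore] -/
theorem abs_entry_transpose_le {M : Matrix (Fin 3) (Fin 3) ℝ} {m : ℝ} (hM : ∀ a b, |M a b| ≤ m) (a b : Fin 3) : |Mᵀ a b| ≤ m :=
  hM b a

omit [NeZero L] in
/-- Entries of a difference of transposes: `|(Mᵀ − 1)_{ab}| ≤ m` when `|(M − 1)_{ab}| ≤ m`. [folklore] -/
theorem abs_entry_transpose_sub_one_le {M : Matrix (Fin 3) (Fin 3) ℝ} {m : ℝ} (hM : ∀ a b, |(M - 1) a b| ≤ m) (a b : Fin 3) :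
    |(Mᵀ - 1) a b| ≤ m := by
  have h := hM b a
  rw [Matrix.sub_apply, Matrix.one_apply] at h ⊢
  rw [Matrix.transpose_apply]
  by_cases hab : a = b
  · subst hab; simpa using h
  · rw [if_neg hab]; rw [if_neg (Ne.symm hab)] at h; exact h

omit [NeZero L] in
/-- `|Σ_b M_{ab} w_b| ≤ 3 m ρ` for `|M| ≤ m`, `|w| ≤ ρ`. [folklore] -/
theorem abs_sum_entry_mul_le {M : Matrix (Fin 3) (Fin 3) ℝ} {m ρ : ℝ} (hM : ∀ a b, |M a b| ≤ m) {w : Fin 3 → ℝ} (hw : ∀ b, |w b| ≤ ρ)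
    (a : Fin 3) : |∑ b, M a b * w b| ≤ 3 * m * ρ := by
  have hm : 0 ≤ m := (abs_nonneg _).trans (hM 0 0)
  calc |∑ b, M a b * w b| ≤ ∑ b, |M a b * w b| := Finset.abs_sum_le_sum_abs _ _
    _ ≤ ∑ _b : Fin 3, m * ρ := Finset.sum_le_sum fun b _ => by
        rw [abs_mul]; exact mul_le_mul (hM a b) (hw b) (abs_nonneg _) hm
    _ = 3 * m * ρ := by simp; ring

/-! ## §2 `Ad(W)` is `4τ`-close to `1` for a near step -/

omit [NeZero L] in
/-- ★ For `|vecPart(W)_c| ≤ τ ≤ 1`, every entry of `Ad(W) − 1` is at most `4τ` in absolute value (diagonal: `−2(r²+s²)` etc., off-diagonal: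
`2(qr ∓ ps)` etc., with `p² + q² + r² + s² = 1`). [cite: BrockerTomDieck1985, I (1.10)] -/
theorem abs_adRot_sub_one_le (W : SU2) {τ : ℝ} (hτ1 : τ ≤ 1) (hw : ∀ c, |vecPart W c| ≤ τ) (a b : Fin 3) :
    |(adRot W - 1) a b| ≤ 4 * τ := by
  have hτ0 : 0 ≤ τ := (abs_nonneg _).trans (hw 0)
  have hsum := su2_sq_sum W
  set p := ((W : Matrix (Fin 2) (Fin 2) ℂ) 0 0).re with hp
  set q := ((W : Matrix (Fin 2) (Fin 2) ℂ) 0 0).im with hq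
  set r := ((W : Matrix (Fin 2) (Fin 2) ℂ) 0 1).re with hr
  set s := ((W : Matrix (Fin 2) (Fin 2) ℂ) 0 1).im with hs
  have hqτ : |q| ≤ τ := by have := hw 0; rwa [vecPart_zero] at this
  have hrτ : |r| ≤ τ := by have := hw 1; rwa [vecPart_one] at this
  have hsτ : |s| ≤ τ := by have := hw 2; rwa [vecPart_two] at this
  have hp1 : |p| ≤ 1 := by have := abs_scalarPart_le W; rwa [scalarPart_eq] at this
  obtain ⟨hq1, hq2⟩ := abs_le.mp hqτ
  obtain ⟨hr1, hr2⟩ := abs_le.mp hrτ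
  obtain ⟨hs1, hs2⟩ := abs_le.mp hsτ
  obtain ⟨hp1', hp2'⟩ := abs_le.mp hp1
  -- squares and products, in linear form
  have hq2' : q ^ 2 ≤ τ ^ 2 := by nlinarith
  have hr2' : r ^ 2 ≤ τ ^ 2 := by nlinarith
  have hs2' : s ^ 2 ≤ τ ^ 2 := by nlinarith
  have hττ : τ ^ 2 ≤ τ := by nlinarith
  have hprod : ∀ x y : ℝ, |x| ≤ τ → |y| ≤ τ → -τ ≤ x * y ∧ x * y ≤ τ := fun x y hx hy => by
    have h : |x * y| ≤ τ := by
      rw [abs_mul]; nlinarith [abs_nonneg x, abs_nonneg y, mul_le_mul hx hy (abs_nonneg _) hτ0]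
    exact abs_le.mp h
  have hpprod : ∀ y : ℝ, |y| ≤ τ → -τ ≤ p * y ∧ p * y ≤ τ := fun y hy => by
    have h : |p * y| ≤ τ := by
      rw [abs_mul]; nlinarith [abs_nonneg p, abs_nonneg y, mul_le_mul hp1 hy (abs_nonneg _) zero_le_one]
    exact abs_le.mp h
  obtain ⟨hqr1, hqr2⟩ := hprod q r hqτ hrτ
  obtain ⟨hqs1, hqs2⟩ := hprod q s hqτ hsτ
  obtain ⟨hrs1, hrs2⟩ := hprod r s hrτ hsτ
  obtain ⟨hps1, hps2⟩ := hpprod s hsτ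
  obtain ⟨hpr1, hpr2⟩ := hpprod r hrτ
  obtain ⟨hpq1, hpq2⟩ := hpprod q hqτ
  rw [Matrix.sub_apply, Matrix.one_apply, abs_le]
  fin_cases a <;> fin_cases b <;> simp [adRot, ← hp, ← hq, ← hr, ← hs] <;> constructor <;>
    linarith [hsum, hq2', hr2', hs2', hττ, sq_nonneg q, sq_nonneg r, sq_nonneg s]

/-! ## §3 The three transports along a step: telescoping identities and entry bounds -/

section Step

variable (W U : GaugeConfig 3 L SU2) (p : Plaquette 3 L)

omit [NeZero L] in
/-- `Ad(P₁(W·U)) − Ad(P₁(U)) = (Ad(W₁) − 1)·Ad(U₁)`. [cite: Luscher1983, §3] -/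
theorem adRot_ptrans1_step_sub :
    adRot (ptrans1 (W * U) p) - adRot (ptrans1 U p) = (adRot (W (p.1, p.2.1.1)) - 1) * adRot (U (p.1, p.2.1.1)) := by
  simp only [ptrans1, Pi.mul_apply, adRot_mul]
  noncomm_ring

omit [NeZero L] in
/-- `Ad(P₂(W·U)) − Ad(P₂(U))` telescoped into three terms, each `(Ad(W_e)^{±1} − 1)` sandwiched between adjoint rotations. [cite: Luscher1983, §3] -/
theorem adRot_ptrans2_step_sub :
    adRot (ptrans2 (W * U) p) - adRot (ptrans2 U p) =
      (adRot (W (p.1, p.2.1.1)) - 1) *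
          adRot (U (p.1, p.2.1.1) * W (p.1.shift p.2.1.1, p.2.1.2) * U (p.1.shift p.2.1.1, p.2.1.2) *
            (U (p.1.shift p.2.1.2, p.2.1.1))⁻¹ * (W (p.1.shift p.2.1.2, p.2.1.1))⁻¹) +
        adRot (U (p.1, p.2.1.1)) * (adRot (W (p.1.shift p.2.1.1, p.2.1.2)) - 1) *
          adRot (U (p.1.shift p.2.1.1, p.2.1.2) * (U (p.1.shift p.2.1.2, p.2.1.1))⁻¹ * (W (p.1.shift p.2.1.2, p.2.1.1))⁻¹) +
        adRot (U (p.1, p.2.1.1) * U (p.1.shift p.2.1.1, p.2.1.2) * (U (p.1.shift p.2.1.2, p.2.1.1))⁻¹) *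
          ((adRot (W (p.1.shift p.2.1.2, p.2.1.1)))ᵀ - 1) := by
  simp only [ptrans2, Pi.mul_apply, mul_inv_rev, adRot_mul, adRot_inv]
  noncomm_ring

omit [NeZero L] in
/-- `Ad(hol(W·U)) − Ad(hol(U))` telescoped into four terms. [cite: Luscher1983, §3] -/
theorem adRot_hol_step_sub :
    adRot (hol (W * U) p) - adRot (hol U p) =
      (adRot (W (p.1, p.2.1.1)) - 1) *
          adRot (U (p.1, p.2.1.1) * W (p.1.shift p.2.1.1, p.2.1.2) * U (p.1.shift p.2.1.1, p.2.1.2) *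
            (U (p.1.shift p.2.1.2, p.2.1.1))⁻¹ * (W (p.1.shift p.2.1.2, p.2.1.1))⁻¹ * (U (p.1, p.2.1.2))⁻¹ * (W (p.1, p.2.1.2))⁻¹) +
        adRot (U (p.1, p.2.1.1)) * (adRot (W (p.1.shift p.2.1.1, p.2.1.2)) - 1) *
          adRot (U (p.1.shift p.2.1.1, p.2.1.2) * (U (p.1.shift p.2.1.2, p.2.1.1))⁻¹ * (W (p.1.shift p.2.1.2, p.2.1.1))⁻¹ *
            (U (p.1, p.2.1.2))⁻¹ * (W (p.1, p.2.1.2))⁻¹) +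
        adRot (U (p.1, p.2.1.1) * U (p.1.shift p.2.1.1, p.2.1.2) * (U (p.1.shift p.2.1.2, p.2.1.1))⁻¹) *
          ((adRot (W (p.1.shift p.2.1.2, p.2.1.1)))ᵀ - 1) * adRot ((U (p.1, p.2.1.2))⁻¹ * (W (p.1, p.2.1.2))⁻¹) +
        adRot (U (p.1, p.2.1.1) * U (p.1.shift p.2.1.1, p.2.1.2) * (U (p.1.shift p.2.1.2, p.2.1.1))⁻¹ * (U (p.1, p.2.1.2))⁻¹) *
          ((adRot (W (p.1, p.2.1.2)))ᵀ - 1) := by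
  simp only [hol, plaquetteHolonomy, Pi.mul_apply, mul_inv_rev, adRot_mul, adRot_inv]
  noncomm_ring

variable {W} {τ : ℝ} (hτ1 : τ ≤ 1) (hw : ∀ (e : Edge 3 L) (c : Fin 3), |vecPart (W e) c| ≤ τ)
include hτ1 hw

omit [NeZero L] in
/-- `|Ad(P₁(W·U)) − Ad(P₁(U))| ≤ 12τ` entrywise. [cite: Luscher1983, §3] -/
theorem abs_adRot_ptrans1_step_sub_le (a b : Fin 3) : |(adRot (ptrans1 (W * U) p) - adRot (ptrans1 U p)) a b| ≤ 12 * τ := by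
  rw [adRot_ptrans1_step_sub]
  refine (abs_entry_mul_adRot_le (abs_adRot_sub_one_le _ hτ1 (hw _)) _ a b).trans (by linarith)

omit [NeZero L] in
/-- `|Ad(P₂(W·U)) − Ad(P₂(U))| ≤ 60τ` entrywise. [cite: Luscher1983, §3] -/
theorem abs_adRot_ptrans2_step_sub_le (a b : Fin 3) : |(adRot (ptrans2 (W * U) p) - adRot (ptrans2 U p)) a b| ≤ 60 * τ := by
  rw [adRot_ptrans2_step_sub]
  have h1 := abs_entry_mul_adRot_le (abs_adRot_sub_one_le (W (p.1, p.2.1.1)) hτ1 (hw _))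
    (U (p.1, p.2.1.1) * W (p.1.shift p.2.1.1, p.2.1.2) * U (p.1.shift p.2.1.1, p.2.1.2) *
      (U (p.1.shift p.2.1.2, p.2.1.1))⁻¹ * (W (p.1.shift p.2.1.2, p.2.1.1))⁻¹) a b
  have h2 := abs_entry_mul_adRot_le (abs_entry_adRot_mul_le (U (p.1, p.2.1.1))
    (abs_adRot_sub_one_le (W (p.1.shift p.2.1.1, p.2.1.2)) hτ1 (hw _)))
    (U (p.1.shift p.2.1.1, p.2.1.2) * (U (p.1.shift p.2.1.2, p.2.1.1))⁻¹ * (W (p.1.shift p.2.1.2, p.2.1.1))⁻¹) a b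
  have h3 := abs_entry_adRot_mul_le (U (p.1, p.2.1.1) * U (p.1.shift p.2.1.1, p.2.1.2) * (U (p.1.shift p.2.1.2, p.2.1.1))⁻¹)
    (abs_entry_transpose_sub_one_le (abs_adRot_sub_one_le (W (p.1.shift p.2.1.2, p.2.1.1)) hτ1 (hw _))) a b
  rw [Matrix.add_apply, Matrix.add_apply]
  refine (abs_add_le _ _).trans ((add_le_add (abs_add_le _ _) le_rfl).trans ?_)
  linarith

omit [NeZero L] in
/-- `|Ad(hol(W·U)) − Ad(hol(U))| ≤ 96τ` entrywise. [cite: Luscher1983, §3] -/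
theorem abs_adRot_hol_step_sub_le (a b : Fin 3) : |(adRot (hol (W * U) p) - adRot (hol U p)) a b| ≤ 96 * τ := by
  rw [adRot_hol_step_sub]
  have h1 := abs_entry_mul_adRot_le (abs_adRot_sub_one_le (W (p.1, p.2.1.1)) hτ1 (hw _))
    (U (p.1, p.2.1.1) * W (p.1.shift p.2.1.1, p.2.1.2) * U (p.1.shift p.2.1.1, p.2.1.2) *
      (U (p.1.shift p.2.1.2, p.2.1.1))⁻¹ * (W (p.1.shift p.2.1.2, p.2.1.1))⁻¹ * (U (p.1, p.2.1.2))⁻¹ * (W (p.1, p.2.1.2))⁻¹) a b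
  have h2 := abs_entry_mul_adRot_le (abs_entry_adRot_mul_le (U (p.1, p.2.1.1))
    (abs_adRot_sub_one_le (W (p.1.shift p.2.1.1, p.2.1.2)) hτ1 (hw _)))
    (U (p.1.shift p.2.1.1, p.2.1.2) * (U (p.1.shift p.2.1.2, p.2.1.1))⁻¹ * (W (p.1.shift p.2.1.2, p.2.1.1))⁻¹ *
      (U (p.1, p.2.1.2))⁻¹ * (W (p.1, p.2.1.2))⁻¹) a b
  have h3 := abs_entry_mul_adRot_le (abs_entry_adRot_mul_le
    (U (p.1, p.2.1.1) * U (p.1.shift p.2.1.1, p.2.1.2) * (U (p.1.shift p.2.1.2, p.2.1.1))⁻¹)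
    (abs_entry_transpose_sub_one_le (abs_adRot_sub_one_le (W (p.1.shift p.2.1.2, p.2.1.1)) hτ1 (hw _))))
    ((U (p.1, p.2.1.2))⁻¹ * (W (p.1, p.2.1.2))⁻¹) a b
  have h4 := abs_entry_adRot_mul_le
    (U (p.1, p.2.1.1) * U (p.1.shift p.2.1.1, p.2.1.2) * (U (p.1.shift p.2.1.2, p.2.1.1))⁻¹ * (U (p.1, p.2.1.2))⁻¹)
    (abs_entry_transpose_sub_one_le (abs_adRot_sub_one_le (W (p.1, p.2.1.2)) hτ1 (hw _))) a b
  rw [Matrix.add_apply, Matrix.add_apply, Matrix.add_apply]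
  refine (abs_add_le _ _).trans ((add_le_add ((abs_add_le _ _).trans (add_le_add (abs_add_le _ _) le_rfl)) le_rfl).trans ?_)
  linarith

end Step

/-! ## §4 Operator bounds -/

/-- A coordinate is bounded by the Euclidean norm: `|w_{e,b}| ≤ ‖w‖`. [folklore] -/
theorem abs_apply_le_norm (w : LinkSpace L) (e : Edge 3 L) (b : Fin 3) : |w (e, b)| ≤ ‖w‖ := by
  have h := PiLp.norm_apply_le w (e, b)
  rwa [Real.norm_eq_abs] at h

/-- ★ **Operator bound of the covariant curl**: `‖D_U w‖ ≤ 10 √N ‖w‖`, `N = 3|P|`. [cite: Luscher1983, §3] -/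
theorem norm_covCurl_le_op (U : GaugeConfig 3 L SU2) (w : LinkSpace L) :
    ‖covCurl U w‖ ≤ 10 * Real.sqrt (Fintype.card (Plaquette 3 L × Fin 3)) * ‖w‖ := by
  have h := norm_covCurl_le U (w := w) (ρ := ‖w‖) (norm_nonneg _) fun e b => abs_apply_le_norm w e b
  linarith [h]

omit [NeZero L] in
/-- Components of the difference `(D_{W·U} − D_U) w`: only the three transported terms move. [cite: Luscher1983, §3] -/
theorem covCurl_step_sub_apply (W U : GaugeConfig 3 L SU2) (w : LinkSpace L) (x : Site 3 L) (ij : {q : Fin 3 × Fin 3 // q.1 < q.2})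
    (a : Fin 3) :
    (covCurl (W * U) w - covCurl U w) ((x, ij), a) =
      ∑ b, (adRot (ptrans1 (W * U) (x, ij)) - adRot (ptrans1 U (x, ij))) a b * w ((x.shift ij.1.1, ij.1.2), b)
        - ∑ b, (adRot (ptrans2 (W * U) (x, ij)) - adRot (ptrans2 U (x, ij))) a b * w ((x.shift ij.1.2, ij.1.1), b)
        - ∑ b, (adRot (hol (W * U) (x, ij)) - adRot (hol U (x, ij))) a b * w ((x, ij.1.2), b) := by
  rw [PiLp.sub_apply, covCurl_apply, covCurl_apply]
  simp only [Matrix.sub_apply, sub_mul, Finset.sum_sub_distrib]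
  ring

/-- ★★ **THE COVARIANT CURL IS LIPSCHITZ ALONG A NEAR STEP**: for `|vecPart(W_e)_c| ≤ τ ≤ 1` on every link,
`‖D_{W·U} w − D_U w‖ ≤ 504 τ √N ‖w‖`. [cite: Luscher1983, §3] -/
theorem norm_covCurl_step_sub_le {W : GaugeConfig 3 L SU2} (U : GaugeConfig 3 L SU2) {τ : ℝ} (hτ1 : τ ≤ 1)
    (hw : ∀ (e : Edge 3 L) (c : Fin 3), |vecPart (W e) c| ≤ τ) (w : LinkSpace L) :
    ‖covCurl (W * U) w - covCurl U w‖ ≤ 504 * τ * Real.sqrt (Fintype.card (Plaquette 3 L × Fin 3)) * ‖w‖ := by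
  have hτ0 : 0 ≤ τ := (abs_nonneg _).trans (hw default 0)
  have hq : ∀ q : Plaquette 3 L × Fin 3, |(covCurl (W * U) w - covCurl U w) q| ≤ 504 * τ * ‖w‖ := by
    rintro ⟨⟨x, ij⟩, a⟩
    rw [covCurl_step_sub_apply]
    have h1 := abs_sum_entry_mul_le (abs_adRot_ptrans1_step_sub_le U (x, ij) hτ1 hw) (w := fun b => w ((x.shift ij.1.1, ij.1.2), b))
      (fun b => abs_apply_le_norm w _ b) a
    have h2 := abs_sum_entry_mul_le (abs_adRot_ptrans2_step_sub_le U (x, ij) hτ1 hw) (w := fun b => w ((x.shift ij.1.2, ij.1.1), b))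
      (fun b => abs_apply_le_norm w _ b) a
    have h3 := abs_sum_entry_mul_le (abs_adRot_hol_step_sub_le U (x, ij) hτ1 hw) (w := fun b => w ((x, ij.1.2), b))
      (fun b => abs_apply_le_norm w _ b) a
    refine (abs_sub _ _).trans ((add_le_add ((abs_sub _ _).trans (add_le_add h1 h2)) h3).trans ?_)
    linarith
  have h := norm_le_sqrt_card_mul (by positivity : (0 : ℝ) ≤ 504 * τ * ‖w‖) hq
  linarith [h]

end Summit.QuantumFields.YangMills.Theorems.FemtoTransferGap.TwoLattice.Cov

end
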